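import Mathlib
import Summits.Ventures.PercRepro.TriangleCapSparseTwo

/-!
# PercRepro — THE ONE-TRIANGLE CASE TWO BELOW THE DIAGONAL, PART A: the union bound on far pairs and the two
exceptional families (p3, gen 36; part 48)

For the `r = 2` stability on `K₄⁻`-free graphs with exactly one triangle `u v w`, §10au's far-pair count needs
`q + ab + bc + ca ≥ a + b + c + 3` on the partition `a + b + c + q + 3 = k` (private neighbourhoods `a, b, c`, outer
vertices `q`), which fails on exactly two infinite families once `k ≥ 10` (§10az(k′)): `(0, 1, c, q ≤ 3)` and
`(a, 0, 0, q)`.  Both are paid by a cruder count: the far pairs of `z` are all but those touching `N(z)`, so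
`2m ≤ far(z) + 2 Σ_{x ∈ N(z)} d(x)` (`two_mul_card_edges_le_far_add`), which is sharp when `N(z)` is small —
`N(u) = {v, w}` when `priv u = ∅`.

* `deg_eq_two_add_card_priv` — `d(u) = 2 + |priv u|` in a `K₄⁻`-free graph with a triangle `u v w`;
* `two_mul_card_edges_le_far_add` — the union bound;
* `far_ge_two_of_edge` — an edge with both ends non-adjacent to `z` gives `far(z) ≥ 2`;
* **`deficit_family_one`** — `priv u = ∅`, `|priv v| = 1`, at least one outer vertex, `m ≥ 2k − 3` ⇒
  `4k ≤ Σ deficit + 6`;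
* **`deficit_family_two`** — `priv v = priv w = ∅`, at least one outer vertex, `m ≥ 2k − 3` ⇒ `4k ≤ Σ deficit + 6`.
Axioms: standard.
-/

namespace PercRepro

namespace TriangleCap

namespace C047

open Finset

variable {V : Type*} [Fintype V] [DecidableEq V]

/-- The neighbours of `u` are `v`, `w` and its private neighbours. -/
theorem nbhd_eq_pair_union_priv (D : SimpleGraph V) [DecidableRel D.Adj] (hK : K4mFree D) {u v w : V}
    (huv : D.Adj u v) (huw : D.Adj u w) (hvw : D.Adj v w) :
    univ.filter (fun x => D.Adj u x) = {v, w} ∪ priv D u v w := by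
  ext x
  simp only [mem_filter, mem_univ, true_and, mem_union, mem_insert, mem_singleton]
  constructor
  · intro hux
    by_cases hxv : x = v
    · exact Or.inl (Or.inl hxv)
    by_cases hxw : x = w
    · exact Or.inl (Or.inr hxw)
    · exact Or.inr (mem_priv_of_adj D hK huv huw hvw hux hxv hxw)
  · rintro ((rfl | rfl) | h)
    · exact huv
    · exact huw
    · exact ((mem_priv D u v w x).mp h).1

/-- `{v, w}` and `priv u` are disjoint. -/
theorem disjoint_pair_priv (D : SimpleGraph V) [DecidableRel D.Adj] {u v w : V} (hvw : D.Adj v w) :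
    Disjoint ({v, w} : Finset V) (priv D u v w) := by
  rw [disjoint_left]
  intro x hx hx'
  rw [mem_insert, mem_singleton] at hx
  rw [mem_priv] at hx'
  rcases hx with rfl | rfl
  · exact hx'.2.2 hvw.symm
  · exact hx'.2.1 hvw

/-- `d(u) = 2 + |priv u|` in a `K₄⁻`-free graph with a triangle `u v w`. -/
theorem deg_eq_two_add_card_priv (D : SimpleGraph V) [DecidableRel D.Adj] (hK : K4mFree D) {u v w : V}
    (huv : D.Adj u v) (huw : D.Adj u w) (hvw : D.Adj v w) :
    deg D u = 2 + (priv D u v w).card := by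
  unfold deg
  rw [nbhd_eq_pair_union_priv D hK huv huw hvw, card_union_of_disjoint (disjoint_pair_priv D hvw),
    card_pair hvw.ne]

/-- **THE UNION BOUND:** every ordered adjacent pair is far from `z` or touches `N(z)`:
`2m ≤ far(z) + 2 Σ_{x ∈ N(z)} d(x)`. -/
theorem two_mul_card_edges_le_far_add (D : SimpleGraph V) [DecidableRel D.Adj] (z : V) :
    2 * D.edgeFinset.card ≤ far D z + 2 * ∑ x ∈ univ.filter (fun x => D.Adj z x), deg D x := by
  have h := card_filter_add_card_filter_not (s := adjPairsAll D) (fun p => ¬ D.Adj p.1 z ∧ ¬ D.Adj p.2 z)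
  rw [card_adjPairsAll] at h
  have hfar : far D z = ((adjPairsAll D).filter (fun p => ¬ D.Adj p.1 z ∧ ¬ D.Adj p.2 z)).card := rfl
  -- the pairs touching `N(z)`
  have e : (adjPairsAll D).filter (fun p => ¬ (¬ D.Adj p.1 z ∧ ¬ D.Adj p.2 z)) =
      (adjPairsAll D).filter (fun p => D.Adj z p.1) ∪ (adjPairsAll D).filter (fun p => D.Adj z p.2) := by
    rw [← filter_or]
    apply filter_congr
    intro p _
    constructor
    · intro h'
      by_contra h''
      rw [not_or] at h''
      exact h' ⟨fun h1 => h''.1 h1.symm, fun h2 => h''.2 h2.symm⟩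
    · rintro (h1 | h2) h'
      · exact h'.1 h1.symm
      · exact h'.2 h2.symm
  have h1 : ((adjPairsAll D).filter (fun p => D.Adj z p.1)).card =
      ∑ x ∈ univ.filter (fun x => D.Adj z x), deg D x := by
    calc ((adjPairsAll D).filter (fun p => D.Adj z p.1)).card
        = ∑ p ∈ adjPairsAll D, (fun v => if D.Adj z v then 1 else 0) p.1 := by rw [card_filter]
      _ = ∑ v, deg D v * (fun v => if D.Adj z v then 1 else 0) v :=
          sum_fst_adjPairsAll D (fun v => if D.Adj z v then 1 else 0)
      _ = ∑ x ∈ univ.filter (fun x => D.Adj z x), deg D x := by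
          rw [sum_filter]
          apply sum_congr rfl
          intro x _
          simp only
          split_ifs <;> simp
  have h2 : ((adjPairsAll D).filter (fun p => D.Adj z p.2)).card =
      ((adjPairsAll D).filter (fun p => D.Adj z p.1)).card := by
    apply card_filter_swap D (fun p => D.Adj z p.2) (fun p => D.Adj z p.1)
    intro p
    rfl
  have hle := card_union_le ((adjPairsAll D).filter (fun p => D.Adj z p.1))
    ((adjPairsAll D).filter (fun p => D.Adj z p.2))
  rw [← e] at hle
  omega

/-- An edge `x y` with both ends non-adjacent to `z` gives two far pairs. -/
theorem far_ge_two_of_edge (D : SimpleGraph V) [DecidableRel D.Adj] {x y z : V} (hxy : D.Adj x y)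
    (hzx : ¬ D.Adj x z) (hzy : ¬ D.Adj y z) : 2 ≤ far D z := by
  unfold far
  have hsub : ({(x, y), (y, x)} : Finset (V × V)) ⊆
      (adjPairsAll D).filter (fun p => ¬ D.Adj p.1 z ∧ ¬ D.Adj p.2 z) := by
    intro p hp
    rw [mem_insert, mem_singleton] at hp
    rw [mem_filter, mem_adjPairsAll]
    rcases hp with rfl | rfl
    · exact ⟨hxy, hzx, hzy⟩
    · exact ⟨hxy.symm, hzy, hzx⟩
  have := card_le_card hsub
  rw [card_pair (fun h => hxy.ne (Prod.mk.inj h).1)] at this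
  exact this

/-- `d(p) ≤ k − 3` for a private neighbour `p` of `v`: it misses `u`, `w` and itself. -/
theorem deg_le_card_sub_three_of_mem_priv (D : SimpleGraph V) [DecidableRel D.Adj] {u v w p : V}
    (huw : D.Adj u w) (hp : p ∈ priv D v u w) : deg D p + 3 ≤ Fintype.card V := by
  rw [mem_priv] at hp
  have hup : u ≠ p := fun h => hp.2.2 (h ▸ huw.symm)
  have hwp : w ≠ p := fun h => hp.2.1 (h ▸ huw)
  have h := deg_le_of_subset D p (univ \ {u, w, p}) (by
    intro y hpy
    rw [mem_sdiff, mem_insert, mem_insert, mem_singleton]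
    refine ⟨mem_univ _, ?_⟩
    rintro (rfl | rfl | rfl)
    · exact hp.2.1 hpy.symm
    · exact hp.2.2 hpy.symm
    · exact hpy.ne rfl)
  rw [card_sdiff, inter_univ, card_univ] at h
  have hc : ({u, w, p} : Finset V).card = 3 := by
    rw [card_insert_of_notMem, card_pair hwp]
    rw [mem_insert, mem_singleton]
    rintro (h' | h')
    · exact huw.ne h'
    · exact hup h'
  have hle : ({u, w, p} : Finset V).card ≤ Fintype.card V := by
    rw [← card_univ]; exact card_le_univ _
  omega

/-- **FAMILY ONE:** `priv u = ∅`, `|priv v| = 1`, an outer vertex, `m ≥ 2k − 3` ⇒ `4k ≤ Σ deficit + 6`. -/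
theorem deficit_family_one (D : SimpleGraph V) [DecidableRel D.Adj] (hK : K4mFree D) {u v w : V}
    (huv : D.Adj u v) (huw : D.Adj u w) (hvw : D.Adj v w)
    (hpu : priv D u v w = ∅) (hpv : (priv D v u w).card = 1) (hq : 1 ≤ (outer D u v w).card)
    (hm : 2 * Fintype.card V ≤ D.edgeFinset.card + 3) :
    4 * Fintype.card V ≤ ∑ p ∈ adjPairsAll D, deficit D p + 6 := by
  obtain ⟨p, hp⟩ := card_eq_one.mp hpv
  have hpmem : p ∈ priv D v u w := by rw [hp]; exact mem_singleton_self _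
  have hp' := (mem_priv D v u w p).mp hpmem
  have hvu : D.Adj v u := huv.symm
  have hwu : D.Adj w u := huw.symm
  have hwv : D.Adj w v := hvw.symm
  have hpart := card_partition_triangle D hK huv huw hvw
  rw [hpu, hpv, card_empty] at hpart
  set c := (priv D w u v).card with hc
  set q := (outer D u v w).card with hq'
  -- degrees
  have hdu : deg D u = 2 := by rw [deg_eq_two_add_card_priv D hK huv huw hvw, hpu, card_empty]
  have hdv : deg D v = 3 := by rw [deg_eq_two_add_card_priv D hK hvu hvw huw, hpv]
  have hdw : deg D w = 2 + c := deg_eq_two_add_card_priv D hK hwu hwv huv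
  have hdp := deg_le_card_sub_three_of_mem_priv D huw hpmem
  -- the union bounds at `u` and `v`
  have hu := two_mul_card_edges_le_far_add D u
  rw [nbhd_eq_pair_union_priv D hK huv huw hvw, hpu, union_empty, sum_pair hvw.ne, hdv, hdw] at hu
  have hv := two_mul_card_edges_le_far_add D v
  have hdisj : Disjoint ({u, w} : Finset V) {p} := by
    have := disjoint_pair_priv D (u := v) huw
    rwa [hp] at this
  rw [nbhd_eq_pair_union_priv D hK hvu hvw huw, hp, sum_union hdisj, sum_pair huw.ne, sum_singleton, hdu, hdw] at hv
  -- far pairs at `p`, at `priv w`, at the outer vertices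
  have hfp : 2 ≤ far D p := far_ge_two_of_edge D huw hp'.2.1 hp'.2.2
  have hB : 2 * c ≤ ∑ z ∈ priv D w u v, far D z := by
    rw [hc, card_eq_sum_ones, mul_sum]
    apply sum_le_sum
    intro z hz
    have hz' := (mem_priv D w u v z).mp hz
    simpa using far_ge_two_of_edge D huv hz'.2.1 hz'.2.2
  have hC : 6 * q ≤ ∑ z ∈ outer D u v w, far D z := by
    rw [hq', card_eq_sum_ones, mul_sum]
    apply sum_le_sum
    intro z hz
    simpa using far_ge_six_of_mem_outer D huv huw hvw hz
  -- the subset sum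
  have hup : u ≠ p := fun h => hp'.2.2 (h ▸ hwu)
  have hvp : v ≠ p := hp'.1.ne
  have hS : far D u + far D v + far D p + ∑ z ∈ priv D w u v, far D z + ∑ z ∈ outer D u v w, far D z ≤
      ∑ z, far D z := by
    have hd1 : Disjoint (priv D w u v) (outer D u v w) := by
      rw [disjoint_left]
      intro z h1 h2
      rw [mem_priv] at h1
      rw [mem_outer] at h2
      exact h2.2.2 h1.1
    have hd2 : Disjoint ({u, v, p} : Finset V) (priv D w u v ∪ outer D u v w) := by
      rw [disjoint_left]
      intro z h1 h2
      rw [mem_insert, mem_insert, mem_singleton] at h1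
      rw [mem_union, mem_priv, mem_outer] at h2
      rcases h1 with rfl | rfl | rfl
      · rcases h2 with h | h
        · exact h.2.2 hvu
        · exact h.2.1 hvu
      · rcases h2 with h | h
        · exact h.2.1 huv
        · exact h.1 huv
      · rcases h2 with h | h
        · exact hp'.2.2 h.1
        · exact h.2.1 hp'.1
    have e : ∑ z ∈ ({u, v, p} : Finset V) ∪ (priv D w u v ∪ outer D u v w), far D z =
        far D u + far D v + far D p + ∑ z ∈ priv D w u v, far D z + ∑ z ∈ outer D u v w, far D z := by
      rw [sum_union hd2, sum_union hd1, sum_insert, sum_insert, sum_singleton]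
      · ring
      · rw [mem_singleton]; exact hvp
      · rw [mem_insert, mem_singleton]; rintro (h | h); exact huv.ne h; exact hup h
    rw [← e]
    exact sum_le_sum_of_subset_of_nonneg (subset_univ _) (fun _ _ _ => Nat.zero_le _)
  rw [sum_deficit_eq_sum_far]
  omega

/-- **FAMILY TWO:** `priv v = priv w = ∅`, an outer vertex, `m ≥ 2k − 3` ⇒ `4k ≤ Σ deficit + 6`. -/
theorem deficit_family_two (D : SimpleGraph V) [DecidableRel D.Adj] (hK : K4mFree D) {u v w : V}
    (huv : D.Adj u v) (huw : D.Adj u w) (hvw : D.Adj v w)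
    (hpv : priv D v u w = ∅) (hpw : priv D w u v = ∅) (hq : 1 ≤ (outer D u v w).card)
    (hm : 2 * Fintype.card V ≤ D.edgeFinset.card + 3) :
    4 * Fintype.card V ≤ ∑ p ∈ adjPairsAll D, deficit D p + 6 := by
  have hvu : D.Adj v u := huv.symm
  have hwu : D.Adj w u := huw.symm
  have hwv : D.Adj w v := hvw.symm
  have hpart := card_partition_triangle D hK huv huw hvw
  rw [hpv, hpw, card_empty] at hpart
  set a := (priv D u v w).card with ha
  set q := (outer D u v w).card with hq'
  have hdu : deg D u = 2 + a := deg_eq_two_add_card_priv D hK huv huw hvw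
  have hdv : deg D v = 2 := by rw [deg_eq_two_add_card_priv D hK hvu hvw huw, hpv, card_empty]
  have hdw : deg D w = 2 := by rw [deg_eq_two_add_card_priv D hK hwu hwv huv, hpw, card_empty]
  have hv := two_mul_card_edges_le_far_add D v
  rw [nbhd_eq_pair_union_priv D hK hvu hvw huw, hpv, union_empty, sum_pair huw.ne, hdu, hdw] at hv
  have hw := two_mul_card_edges_le_far_add D w
  rw [nbhd_eq_pair_union_priv D hK hwu hwv huv, hpw, union_empty, sum_pair huv.ne, hdu, hdv] at hw
  have hA : 2 * a ≤ ∑ z ∈ priv D u v w, far D z := by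
    rw [ha, card_eq_sum_ones, mul_sum]
    apply sum_le_sum
    intro z hz
    have hz' := (mem_priv D u v w z).mp hz
    simpa using far_ge_two_of_edge D hvw hz'.2.1 hz'.2.2
  have hC : 6 * q ≤ ∑ z ∈ outer D u v w, far D z := by
    rw [hq', card_eq_sum_ones, mul_sum]
    apply sum_le_sum
    intro z hz
    simpa using far_ge_six_of_mem_outer D huv huw hvw hz
  have hS : far D v + far D w + ∑ z ∈ priv D u v w, far D z + ∑ z ∈ outer D u v w, far D z ≤
      ∑ z, far D z := by
    have hd1 : Disjoint (priv D u v w) (outer D u v w) := by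
      rw [disjoint_left]
      intro z h1 h2
      rw [mem_priv] at h1
      rw [mem_outer] at h2
      exact h2.1 h1.1
    have hd2 : Disjoint ({v, w} : Finset V) (priv D u v w ∪ outer D u v w) := by
      rw [disjoint_left]
      intro z h1 h2
      rw [mem_insert, mem_singleton] at h1
      rw [mem_union, mem_priv, mem_outer] at h2
      rcases h1 with rfl | rfl
      · rcases h2 with h | h
        · exact h.2.2 hwv
        · exact h.1 huv
      · rcases h2 with h | h
        · exact h.2.1 hvw
        · exact h.1 huw
    have e : ∑ z ∈ ({v, w} : Finset V) ∪ (priv D u v w ∪ outer D u v w), far D z =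
        far D v + far D w + ∑ z ∈ priv D u v w, far D z + ∑ z ∈ outer D u v w, far D z := by
      rw [sum_union hd2, sum_union hd1, sum_pair hvw.ne]
      ring
    rw [← e]
    exact sum_le_sum_of_subset_of_nonneg (subset_univ _) (fun _ _ _ => Nat.zero_le _)
  rw [sum_deficit_eq_sum_far]
  omega

end C047

end TriangleCap

end PercRepro
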